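import Literature.AlgebraicGeometry.Motives.GeneratingSectionsFieldTransport
import Literature.AlgebraicGeometry.Motives.CompleteLinearSystemClosedImmersion
import Literature.AlgebraicGeometry.HodgeTheory.AbelianVarietyLefschetzEmbeddingComplex
import Literature.AlgebraicGeometry.AbelianSchemes.PolarizedTripleRigidityDescent
import Literature.AlgebraicGeometry.Motives.CartierDivisorPullbackLineBundleIso
import Literature.AlgebraicGeometry.Motives.CartierDivisorLinEquivIso
import Literature.AlgebraicGeometry.Modules.LineBundleOfCocycleClass
import Literature.AlgebraicGeometry.Modules.VanishingLocusFiniteLocallyFree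
import Literature.AlgebraicGeometry.Morphisms.CohOfVectorBundle
import Literature.FieldTheory.AlgClosed.EmbeddingIntoComplex
import HarnessLib

/-!
# Lefschetz: `3Θ` is very ample on an abelian variety over ANY field of characteristic `0`

Topic `Literature/AlgebraicGeometry/AbelianVarieties`; namespace `Literature.AlgebraicGeometry.Motives.AbelianVariety`; THEOREMS
ONLY (no definition, no named fact, no instance, no notation, no `sorry`).  Cell hodgecm-mathlib, F-6 functor side, LEFSCHETZ
socket (B4) (B-plan1 (g16) 07:58:04Z; census `B-provers/B-p16/g15/CENSUS-L1-Lefschetz3ThetaVeryAmple.B-p16g15.md`, road B;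
consumer (FS-b) `AbelianSchemes/PolarizedLevelFrameEmbedding`).  HC_CM is proved only modulo the 7 printed citations until
rung 0 closes; nothing here is about HC.

**`AbelianVariety.isClosedImmersion_toProj_of_iso_lineBundle_three_nsmul`**: `A` an abelian variety over a field `K` of
characteristic `0`, `Θ` an AMPLE Cartier divisor, `M ≅ 𝒪_A(3Θ)` with a rank-one frame system `F`, `s₀, …, sₙ` a family SPANNING
`Γ(A, M)` over `K`.  Then the `sᵢ` generate `M` and the morphism `A → ℙⁿ_K` they define is a CLOSED IMMERSION — Lefschetz's
theorem ([MumfordAV1970] §17) in the complete-linear-system currency of the (h2)∕F-6 chain.  Road: descend `(A, Θ)` to a finitely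
generated `k₁ = ℚ(s₀) ⊆ K` (★ `exists_finset_intermediateField_descent_end_divisor`, EGA IV 8.8.2), spread the ampleness to a finite
stage `k₂ = k₁(s′) ⊆ K` (★ `IsAmple.exists_finset_forall_isAmple_classPullback`), embed the countable `k₂ ↪ ℂ` (★
`nonempty_ringHom_complex_of_countable`); over `ℂ`, Lefschetz ★ `exists_isClosedImmersion_linEquiv_three_nsmul` ((B1), analytic) and
★ `exists_sections_isClosedImmersion_toProj_of_linEquiv_hyperplaneDivisor` ((B2)) give an embedding family of `𝒪(3Θ₂) ⊗ ℂ`, which ★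
`Motives/GeneratingSectionsFieldTransport` brings DOWN to `k₂` (flat base change of `H⁰` + fpqc descent (B3)) and UP to `K`, across
`(A₁ ⊗ k₂) ⊗ K ≅ A`.  Also the form with the generation `hcov` as a binder (`…_of_iSup_eq_top`).

## References
* D. Mumford, *Abelian Varieties* (1970), §17 (Lefschetz's theorem, p. 163). [MumfordAV1970]
* A. Grothendieck, *EGA IV₃* (Publ. Math. IHÉS 28, 1966), Thm. 8.8.2; *EGA III₁* (1961), Prop. (1.4.15). [EGAIV3] [EGAIII1]
* The Stacks Project, Tag 02L6. [StacksProject]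
* R. Hartshorne, *Algebraic Geometry* (1977), II Thm. 7.1. [Hartshorne1977]
-/

noncomputable section

set_option backward.isDefEq.respectTransparency false

open CategoryTheory CategoryTheory.Limits Opposite TopologicalSpace AlgebraicGeometry
open Literature.AlgebraicGeometry.Modules Literature.AlgebraicGeometry.Morphisms
open Literature.AlgebraicGeometry.Motives.GeneratingSections

namespace Literature.AlgebraicGeometry.Motives

/-! ## §3 Lefschetz over any field of characteristic `0` -/

namespace AbelianVariety

open GeneratingSections

/-- **LEFSCHETZ'S THEOREM OVER ANY FIELD OF CHARACTERISTIC `0`, complete-linear-system form.**  `A` an abelian variety over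
a field `K` of characteristic `0`, `Θ` an AMPLE Cartier divisor on `A`, `M ≅ 𝒪_A(3Θ)` an `𝒪_A`-module with a rank-one frame
system `F`, `s₀, …, sₙ ∈ Γ(A, M)` a family SPANNING `Γ(A, M)` over `K`.  Then the `sᵢ` generate `M` (`hcov`) and the morphism
`A → ℙⁿ_K` defined by `(M, s)` is a CLOSED IMMERSION.  Road: descend `(A, Θ)` to a finitely generated `k₁ = ℚ(s) ⊆ K`
(★ `exists_finset_intermediateField_descent_end_divisor`), spread the ampleness to a finite stage `k₂ = k₁(s′) ⊆ K` (★
`IsAmple.exists_finset_forall_isAmple_classPullback`), embed the countable `k₂ ↪ ℂ` (★ `nonempty_ringHom_complex_of_countable`);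
over `ℂ` Lefschetz ★ `exists_isClosedImmersion_linEquiv_three_nsmul` ((B1), [MumfordAV1970] §17) and ★ (B2)
`exists_sections_isClosedImmersion_toProj_of_linEquiv_hyperplaneDivisor` give an embedding family for `𝒪(3Θ₂) ⊗ ℂ` (moved to the
pulled-back frames by ★ (W) `ofCocycleSections_ofFrameSystem_eq_of_iso`), which ★ `isClosedImmersion_toProj_of_fieldExtension`
brings DOWN to `k₂` and ★ `isClosedImmersion_toProj_of_model` brings UP to `K` and across `(A₁ ⊗ k₂) ⊗ K ≅ A`.
[cite: MumfordAV1970, §17] [cite: StacksProject, Tag 02L6] [cite: EGAIII1, Prop. (1.4.15)] [cite: Hartshorne1977, II Thm. 7.1] -/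
theorem isClosedImmersion_toProj_of_iso_lineBundle_three_nsmul {K : Type} [Field K] [CharZero K]
    (A : AbelianVariety K) [IsIntegral A.X.left] {Θ : CartierDivisor A.X.left} (hΘ : Θ.IsAmple)
    (M : A.X.left.Modules) (φ : M ≅ Modules.lineBundle (3 • Θ).toUnitCocycle) (F : FrameSystem M)
    (h1 : ∀ x, F.rank x = 1) {n : ℕ} (s : Fin (n + 1) → Γ(M, ⊤))
    (hs : ∀ σ : Γ(M, ⊤), SecMod.mk (L := M) (ρ := A.X.hom.appTop.hom) (U := ⊤) σ ∈
      Submodule.span Γ(Spec (.of K), ⊤)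
        (Set.range fun j ↦ SecMod.mk (L := M) (ρ := A.X.hom.appTop.hom) (U := ⊤) (s j))) :
    ∃ hcov : ⨆ i, ⨆ x, A.X.left.basicOpen ((CocycleSections.ofFrameSystem F h1 s).coeff i x) = ⊤,
      IsClosedImmersion ((ofCocycleSections F.U (CocycleSections.ofFrameSystem F h1 s) hcov).toProj A.X.hom) := by
  classical
  -- §A the model over a finitely generated field `k₁ = ℚ(s₀) ⊆ K`
  obtain ⟨s₀, hs₀⟩ := exists_finset_intermediateField_descent_end_divisor (F := ℚ) A (J := Fin 0) (fun _ ↦ 𝟙 A) Θ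
  let k₁ : IntermediateField ℚ K := IntermediateField.adjoin ℚ (↑s₀ : Set K)
  obtain ⟨B₁, ε, -, hB₁, hB₁K, Θ₁, -, hcl⟩ := hs₀ k₁ (IntermediateField.subset_adjoin ℚ _)
  haveI := hB₁
  haveI := hB₁K
  haveI := isDominant_toSchemeHom_iso_hom ε
  haveI : IsIso (Hom.toSchemeHom ε.hom) := ⟨Hom.toSchemeHom ε.inv, by
    change Hom.toSchemeHom (ε.hom ≫ ε.inv) = _
    rw [ε.hom_inv_id]; rfl, by
    change Hom.toSchemeHom (ε.inv ≫ ε.hom) = _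
    rw [ε.inv_hom_id]; rfl⟩
  let prK : (B₁.baseChange K).X.left ⟶ B₁.X.left := pullback.fst B₁.X.hom (bcSpec (↥k₁) K)
  have hdomK : IsDominant prK := by
    change IsDominant (baseChangeHomFst (algebraMap (↥k₁) K) B₁.X)
    exact isDominant_baseChangeHomFst_along (algebraMap (↥k₁) K) B₁
  haveI := hdomK
  have hΘ₁ : (Θ.pullback (Hom.toSchemeHom ε.hom)).LinEquiv (Θ₁.pullback prK) :=
    ((CartierDivisor.classPullback_linEquiv_pullback (Hom.toSchemeHom ε.hom) Θ).symm.trans hcl).trans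
      (CartierDivisor.classPullback_linEquiv_pullback prK Θ₁)
  -- §B spread the ampleness to a finite stage `k₂ = k₁(s′) ⊆ K`
  have hampK : (Θ₁.classPullback (pullback.fst B₁.X.hom (bcSpec (↥k₁) K))).IsAmple :=
    (CartierDivisor.classPullback_linEquiv_pullback prK Θ₁).symm.isAmple
      (hΘ₁.isAmple (hΘ.pullback (Hom.toSchemeHom ε.hom)))
  obtain ⟨s', hs'⟩ := CartierDivisor.IsAmple.exists_finset_forall_isAmple_classPullback B₁.X Θ₁ hampK
  let k₂ : IntermediateField (↥k₁) K := IntermediateField.adjoin (↥k₁) (↑s' : Set K)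
  have hsub : (↑s' : Set K) ⊆ Set.range (algebraMap (↥k₂) K) := fun x hx ↦
    ⟨⟨x, IntermediateField.subset_adjoin (↥k₁) _ hx⟩, rfl⟩
  let B₂ : AbelianVariety (↥k₂) := B₁.baseChange (↥k₂)
  haveI : IsIntegral B₂.X.left := inferInstanceAs
    (IsIntegral ↑(Limits.pullback B₁.X.hom (Spec.map (CommRingCat.ofHom (algebraMap (↥k₁) (↥k₂))))))
  let pr₁₂ : B₂.X.left ⟶ B₁.X.left := pullback.fst B₁.X.hom (bcSpec (↥k₁) (↥k₂))
  have hdom₁₂ : IsDominant pr₁₂ := by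
    change IsDominant (baseChangeHomFst (algebraMap (↥k₁) (↥k₂)) B₁.X)
    exact isDominant_baseChangeHomFst_along (algebraMap (↥k₁) (↥k₂)) B₁
  haveI := hdom₁₂
  let Θ₂ : CartierDivisor B₂.X.left := Θ₁.pullback pr₁₂
  have hΘ₂ : Θ₂.IsAmple := (CartierDivisor.classPullback_linEquiv_pullback pr₁₂ Θ₁).isAmple (hs' (↥k₂) hsub)
  -- §C `k₂` is countable of characteristic `0`: embed it into `ℂ`
  haveI : CharZero (↥k₂) := (RingHom.charZero_iff (algebraMap (↥k₂) K).injective).mpr inferInstance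
  haveI : Countable (↥k₂) := by
    rw [← Cardinal.mk_le_aleph0_iff]
    have h₁ : Cardinal.mk (↥k₁) ≤ Cardinal.aleph0 :=
      (IntermediateField.cardinalMk_adjoin_le ℚ (↑s₀ : Set K)).trans (by simp)
    exact (IntermediateField.cardinalMk_adjoin_le (↥k₁) (↑s' : Set K)).trans (by simp [h₁])
  obtain ⟨σ⟩ := Literature.FieldTheory.AlgClosed.nonempty_ringHom_complex_of_countable (↥k₂)
  letI : Algebra (↥k₂) ℂ := σ.toAlgebra
  -- §D over `ℂ`: Lefschetz for `Θ₂ ⊗ ℂ`, and an embedding family of `𝒪(3Θ₂) ⊗ ℂ` in the pulled-back frames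
  let A₂ : AbelianVariety ℂ := B₂.baseChange ℂ
  haveI : IsIntegral A₂.X.left := inferInstanceAs
    (IsIntegral ↑(Limits.pullback B₂.X.hom (Spec.map (CommRingCat.ofHom (algebraMap (↥k₂) ℂ)))))
  let π : A₂.X.left ⟶ B₂.X.left := pullback.fst B₂.X.hom (bcSpec (↥k₂) ℂ)
  have hdomπ : IsDominant π := by
    change IsDominant (baseChangeHomFst (algebraMap (↥k₂) ℂ) B₂.X)
    exact isDominant_baseChangeHomFst_along (algebraMap (↥k₂) ℂ) B₂
  haveI := hdomπ
  haveI : IsAffineHom π := MorphismProperty.pullback_fst _ _ inferInstance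
  let Θ₃ : CartierDivisor A₂.X.left := Θ₂.pullback π
  have hΘ₃ : Θ₃.IsAmple := hΘ₂.pullback π
  obtain ⟨N, Ψ, hΨ, a₀, ha₀, hlin⟩ := A₂.exists_isClosedImmersion_linEquiv_three_nsmul hΘ₃
  haveI := hΨ
  let F₃ : FrameSystem (Modules.lineBundle (3 • Θ₃).toUnitCocycle) := (3 • Θ₃).toUnitCocycle.lineBundleFrameSystem
  obtain ⟨u, hcovu, Hu⟩ :=
    (3 • Θ₃).exists_sections_isClosedImmersion_toProj_of_linEquiv_hyperplaneDivisor A₂.X Ψ a₀ ha₀ hlin F₃ (fun _ ↦ rfl)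
  -- the model module `E₂ = 𝒪(3Θ₂)` on `B₂`, its frames, and `π^*E₂ ≅ 𝒪(3Θ₃)`
  let E₂ : B₂.X.left.Modules := Modules.lineBundle (3 • Θ₂).toUnitCocycle
  let F₂ : FrameSystem E₂ := (3 • Θ₂).toUnitCocycle.lineBundleFrameSystem
  have hE₂ : IsAffineLocalizing E₂ :=
    isAffineLocalizing_of_isFiniteLocallyFree (UnitCocycle.isFiniteLocallyFree_lineBundle _)
  let ψℂ : (Scheme.Modules.pullback π).obj E₂ ≅ Modules.lineBundle (3 • Θ₃).toUnitCocycle :=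
    (3 • Θ₂).pullbackLineBundleIso π ≪≫ eqToIso (by
      change Modules.lineBundle ((3 • Θ₂).pullback π).toUnitCocycle = Modules.lineBundle (3 • Θ₂.pullback π).toUnitCocycle
      rw [CartierDivisor.pullback_smul])
  obtain ⟨hcovu', hWu⟩ :=
    ofCocycleSections_ofFrameSystem_eq_of_iso ψℂ.symm F₃ (F₂.pullback π) (fun _ ↦ rfl) (fun _ ↦ rfl) u hcovu
  have Hu' : IsClosedImmersion ((ofCocycleSections (F₂.pullback π).U (CocycleSections.ofFrameSystem (F₂.pullback π)
      (fun _ ↦ rfl) (fun i ↦ ψℂ.symm.hom.app ⊤ (u i))) hcovu').toProj A₂.X.hom) := by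
    rw [← hWu]
    exact Hu
  -- §E DOWN to `k₂`: a finite spanning family `t` of `Γ(B₂, 𝒪(3Θ₂))` embeds `B₂`
  obtain ⟨m, t, ht⟩ := exists_fin_span_secMod_eq_top B₂.X.hom E₂
    (coh_of_isVectorBundle (UnitCocycle.isFiniteLocallyFree_lineBundle _).isVectorBundle)
  have Hsq : IsPullback π A₂.X.hom B₂.X.hom (Spec.map (CommRingCat.ofHom (algebraMap (↥k₂) ℂ))) :=
    IsPullback.of_hasPullback _ _
  obtain ⟨hcovt, Ht⟩ := isClosedImmersion_toProj_of_fieldExtension Hsq E₂ hE₂ F₂ (fun _ ↦ rfl) (fun _ ↦ rfl) t ht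
    _ hcovu' Hu'
  -- §F UP to `K` and across `(B₁ ⊗ k₂) ⊗ K ≅ B₁ ⊗ K ≅ A`
  let τ : B₂.baseChange K ≅ B₁.baseChange K := baseChangeTowerIso (↥k₁) (↥k₂) K B₁
  haveI := isDominant_toSchemeHom_iso_hom τ
  haveI : IsIso (Hom.toSchemeHom τ.hom) := ⟨Hom.toSchemeHom τ.inv, by
    change Hom.toSchemeHom (τ.hom ≫ τ.inv) = _
    rw [τ.hom_inv_id]; rfl, by
    change Hom.toSchemeHom (τ.inv ≫ τ.hom) = _
    rw [τ.inv_hom_id]; rfl⟩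
  haveI : IsIntegral (B₂.baseChange K).X.left := inferInstanceAs
    (IsIntegral ↑(Limits.pullback B₂.X.hom (Spec.map (CommRingCat.ofHom (algebraMap (↥k₂) K)))))
  let pr : (B₂.baseChange K).X.left ⟶ B₂.X.left := pullback.fst B₂.X.hom (bcSpec (↥k₂) K)
  have hdompr : IsDominant pr := by
    change IsDominant (baseChangeHomFst (algebraMap (↥k₂) K) B₂.X)
    exact isDominant_baseChangeHomFst_along (algebraMap (↥k₂) K) B₂
  haveI := hdompr
  let e : (B₂.baseChange K).X.left ⟶ A.X.left := Hom.toSchemeHom τ.hom ≫ Hom.toSchemeHom ε.hom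
  haveI : IsDominant e := inferInstance
  have he : e ≫ A.X.hom = (B₂.baseChange K).X.hom := by
    change (Hom.toSchemeHom τ.hom ≫ Hom.toSchemeHom ε.hom) ≫ A.X.hom = _
    rw [Category.assoc]
    have h₁ : Hom.toSchemeHom ε.hom ≫ A.X.hom = (B₁.baseChange K).X.hom := Over.w _
    have h₂ : Hom.toSchemeHom τ.hom ≫ (B₁.baseChange K).X.hom = (B₂.baseChange K).X.hom := Over.w _
    rw [h₁, h₂]
  have Hpr : IsPullback pr (e ≫ A.X.hom) B₂.X.hom (Spec.map (CommRingCat.ofHom (algebraMap (↥k₂) K))) := by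
    rw [he]
    exact IsPullback.of_hasPullback _ _
  -- the divisor relation `e^*Θ ∼ pr^*Θ₂`, hence `pr^*𝒪(3Θ₂) ≅ e^*M`
  have sqτ : Hom.toSchemeHom τ.hom ≫ prK = pr ≫ pr₁₂ :=
    toSchemeHom_baseChangeTowerIso_hom_comp_fst (↥k₁) (↥k₂) K B₁
  haveI : IsDominant (Hom.toSchemeHom τ.hom ≫ prK) := inferInstance
  haveI : IsDominant (pr ≫ pr₁₂) := inferInstance
  have hrel₁ : (Θ.pullback e).LinEquiv (Θ₂.pullback pr) := by
    have h1 : (Θ.pullback e).SameDivisor ((Θ.pullback (Hom.toSchemeHom ε.hom)).pullback (Hom.toSchemeHom τ.hom)) :=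
      (CartierDivisor.pullback_pullback_sameDivisor Θ (Hom.toSchemeHom ε.hom) (Hom.toSchemeHom τ.hom)).symm
    have h2 : ((Θ.pullback (Hom.toSchemeHom ε.hom)).pullback (Hom.toSchemeHom τ.hom)).LinEquiv
        ((Θ₁.pullback prK).pullback (Hom.toSchemeHom τ.hom)) := hΘ₁.pullback _
    have h3 : ((Θ₁.pullback prK).pullback (Hom.toSchemeHom τ.hom)).SameDivisor (Θ₂.pullback pr) :=
      ((CartierDivisor.pullback_pullback_sameDivisor Θ₁ prK (Hom.toSchemeHom τ.hom)).trans
        (CartierDivisor.pullback_congr_sameDivisor Θ₁ sqτ)).trans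
        (CartierDivisor.pullback_pullback_sameDivisor Θ₁ pr₁₂ pr).symm
    exact (h1.linEquiv.trans h2).trans h3.linEquiv
  have hrel : ((3 • Θ₂).pullback pr).LinEquiv ((3 • Θ).pullback e) := by
    rw [CartierDivisor.pullback_smul, CartierDivisor.pullback_smul]
    exact (hrel₁.smul 3).symm
  let ψ : (Scheme.Modules.pullback pr).obj E₂ ≅ (Scheme.Modules.pullback e).obj M :=
    (3 • Θ₂).pullbackLineBundleIso pr ≪≫ hrel.nonempty_lineBundle_iso.some ≪≫
      ((3 • Θ).pullbackLineBundleIso e).symm ≪≫ (Scheme.Modules.pullback e).mapIso φ.symm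
  have hM : IsAffineLocalizing M := isAffineLocalizing_of_isFiniteLocallyFree F.isFiniteLocallyFree
  exact isClosedImmersion_toProj_of_model pr e Hpr E₂ F₂ (fun _ ↦ rfl) (fun _ ↦ rfl) t hcovt Ht M hM ψ F h1
    (fun x ↦ h1 _) s hs

/-- The same with the generation of `M` by the `sᵢ` as a binder `hcov` (the shape of the (h2) chain's fibre hypotheses).
[cite: MumfordAV1970, §17] [cite: Hartshorne1977, II Thm. 7.1] -/
theorem isClosedImmersion_toProj_of_iso_lineBundle_three_nsmul_of_iSup_eq_top {K : Type} [Field K] [CharZero K]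
    (A : AbelianVariety K) [IsIntegral A.X.left] {Θ : CartierDivisor A.X.left} (hΘ : Θ.IsAmple)
    (M : A.X.left.Modules) (φ : M ≅ Modules.lineBundle (3 • Θ).toUnitCocycle) (F : FrameSystem M)
    (h1 : ∀ x, F.rank x = 1) {n : ℕ} (s : Fin (n + 1) → Γ(M, ⊤))
    (hs : ∀ σ : Γ(M, ⊤), SecMod.mk (L := M) (ρ := A.X.hom.appTop.hom) (U := ⊤) σ ∈
      Submodule.span Γ(Spec (.of K), ⊤)
        (Set.range fun j ↦ SecMod.mk (L := M) (ρ := A.X.hom.appTop.hom) (U := ⊤) (s j)))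
    (hcov : ⨆ i, ⨆ x, A.X.left.basicOpen ((CocycleSections.ofFrameSystem F h1 s).coeff i x) = ⊤) :
    IsClosedImmersion ((ofCocycleSections F.U (CocycleSections.ofFrameSystem F h1 s) hcov).toProj A.X.hom) := by
  obtain ⟨_, h⟩ := A.isClosedImmersion_toProj_of_iso_lineBundle_three_nsmul hΘ M φ F h1 s hs
  exact h

/-- **Lefschetz for `𝒪_A(3Θ)` itself**: every family spanning `Γ(A, 𝒪_A(3Θ))` over `K` generates and embeds `A ↪ ℙⁿ_K`
(`Θ` ample, `char K = 0`). [cite: MumfordAV1970, §17] [cite: Hartshorne1977, II Thm. 7.1] -/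
theorem isClosedImmersion_toProj_completeLinearSystem_three_nsmul {K : Type} [Field K] [CharZero K]
    (A : AbelianVariety K) [IsIntegral A.X.left] {Θ : CartierDivisor A.X.left} (hΘ : Θ.IsAmple)
    (F : FrameSystem (Modules.lineBundle (3 • Θ).toUnitCocycle)) (h1 : ∀ x, F.rank x = 1) {n : ℕ}
    (s : Fin (n + 1) → Γ(Modules.lineBundle (3 • Θ).toUnitCocycle, ⊤))
    (hs : ∀ σ : Γ(Modules.lineBundle (3 • Θ).toUnitCocycle, ⊤),
      SecMod.mk (L := Modules.lineBundle (3 • Θ).toUnitCocycle) (ρ := A.X.hom.appTop.hom) (U := ⊤) σ ∈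
        Submodule.span Γ(Spec (.of K), ⊤) (Set.range fun j ↦
          SecMod.mk (L := Modules.lineBundle (3 • Θ).toUnitCocycle) (ρ := A.X.hom.appTop.hom) (U := ⊤) (s j))) :
    ∃ hcov : ⨆ i, ⨆ x, A.X.left.basicOpen ((CocycleSections.ofFrameSystem F h1 s).coeff i x) = ⊤,
      IsClosedImmersion ((ofCocycleSections F.U (CocycleSections.ofFrameSystem F h1 s) hcov).toProj A.X.hom) :=
  A.isClosedImmersion_toProj_of_iso_lineBundle_three_nsmul hΘ _ (Iso.refl _) F h1 s hs

end AbelianVariety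

end Literature.AlgebraicGeometry.Motives

end
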